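import Literature.NumberTheory.CubicFields.CubicFieldDiscriminantTwentyThreeDedekindZeta
import Mathlib.NumberTheory.NumberField.ClassNumber
import Mathlib.NumberTheory.NumberField.Units.DirichletTheorem
import HarnessLib

/-!
# The cubic field of discriminant `−23`: signature `(1, 1)`, class number `1` (Minkowski's bound), unit rank `1`, `w = 2`,
# and «`p` is a norm from `𝓞_F` ⟺ `X³ − X − 1` has a root mod `p`» (LMFDB number field 3.1.23.1) — PROVED

Topic `Literature/NumberTheory/CubicFields`, namespace `Literature.NumberTheory.CubicFields.CubicDisc23` (sequel of
`CubicFieldDiscriminantTwentyThree.lean` (`d_F = −23`) and `CubicFieldDiscriminantTwentyThreeDedekindZeta.lean` (`#{𝔞 : N𝔞 = p} = N_p(X³−X−1)`)).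
THEOREMS ONLY (no definition, no named fact, no instance, no notation); lane `lit-hodgefound` seat p25 gen 53, row g53-#5.

## Source

[LMFDB] The L-functions and Modular Forms Database, number field `3.1.23.1` (`x³ − x² + 1`, the same field as `ℚ(α)`, `α³ − α − 1 = 0`: the
cubic field of discriminant `−23` is unique): degree `3`, signature `[1, 1]`, discriminant `−23`, class number `1`, unit rank `1`, torsion
`w = 2` (table entries).  With D. Zagier, *The 1-2-3 of Modular Forms* [Zagier2008] §4.3 p. 59 («`F = ℚ(α)` (`α³ − α − 1 = 0`) is the cubic field
of discriminant `−23`») and J.-P. Serre, *On a theorem of Jordan* [Serre2003Jordan] §5.3 («`N_p(f) = a_p + 1`»; `L(ρ,s) = ζ_E(s)/ζ(s)`).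

## What is formalised (all PROVED; `F` any number field with `[F : ℚ] = 3` containing a root `α` of `X³ − X − 1`)

* ★`nrComplexPlaces_eq_one`, `nrRealPlaces_eq_one`, `card_infinitePlace_eq_two` — **signature `(r₁, r₂) = (1, 1)`** (`sign d_F = (−1)^{r₂}`, Mathlib's
  `NumberField.sign_discr`, with `d_F = −23 < 0` and `r₁ + 2r₂ = 3`).
* ★★`isPrincipalIdealRing`, `classNumber_eq_one` — **`h_F = 1`: `𝓞_F` is a principal ideal domain**, by Minkowski's bound in Mathlib's form
  `RingOfIntegers.isPrincipalIdealRing_of_abs_discr_lt`: `|d_F| = 23 < (2 · (π/4) · 3³/3!)² = 81π²/16 ≈ 49.96`.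
* `units_rank_eq_one` — the unit group has rank `r₁ + r₂ − 1 = 1`; `torsionOrder_eq_two` — `w_F = 2` (odd degree).
* ★`exists_absNorm_span_singleton_eq_iff` / `exists_natAbs_norm_eq_iff` — **a prime `p` is the norm of a principal ideal `(x) ⊆ 𝓞_F` (equivalently
  `|N_{F/ℚ}(x)| = p` for some integer `x` of `F`) iff `X³ − X − 1` has a root modulo `p`** — every ideal is principal and `#{𝔞 : N𝔞 = p} = N_p(f)`
  (the tree's `idealNormCount_prime_eq_ncard_roots`, Serre's «`N_p(f) = a_p + 1`» with Zagier's «`L(s) = ζ_F(s)/ζ(s)`»).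

## Mathlib / tree search
Tree (consumed BY NAME): `CubicDisc23.{discr_eq_neg_twentyThree, idealNormCount_prime_eq_ncard_roots}` (g52-#1, g53-#2), `LFunctions.idealNormCount`.
Mathlib: `NumberField.sign_discr`, `NumberField.InfinitePlace.{card_add_two_mul_card_eq_rank, card_eq_nrRealPlaces_add_nrComplexPlaces}`,
`RingOfIntegers.isPrincipalIdealRing_of_abs_discr_lt` (Minkowski), `NumberField.classNumber_eq_one_iff`, `NumberField.Units.{rank, torsionOrder_eq_two_of_odd_finrank}`,
`Real.pi_gt_three`, `Ideal.absNorm_span_singleton`, `Submodule.IsPrincipal.principal`.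
`rg "classNumber|IsPrincipalIdealRing|nrComplexPlaces" lean/Literature/NumberTheory/CubicFields` → only the form-class numbers `h(D)` of binary cubic
forms (`ClassNumberPos.lean` &c.): the invariants of this field are new in the tree.

## References
* [LMFDB] The LMFDB Collaboration, The L-functions and Modular Forms Database, number field 3.1.23.1.
* [Zagier2008] D. Zagier, The 1-2-3 of Modular Forms, §4.3 p. 59.  [Serre2003Jordan] J.-P. Serre, Bull. AMS 40 (2003) §5.3 and note 5.3.
-/

noncomputable section

open NumberField NumberField.InfinitePlace NumberField.Units Ideal Module
open Literature.NumberTheory.NumberFields.MonicCubic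
open Literature.NumberTheory.LFunctions

namespace Literature.NumberTheory.CubicFields.CubicDisc23

variable {F : Type*} [Field F] [NumberField F] {α : F}

/-! ## §1 Signature `(1, 1)` -/

/-- **`F` has exactly one complex place** (`r₂ = 1`): `d_F = −23 < 0` has sign `(−1)^{r₂}`, and `r₁ + 2r₂ = 3`.
[cite: LMFDB, number field 3.1.23.1 (signature [1,1])] -/
theorem nrComplexPlaces_eq_one (h3 : finrank ℚ F = 3) (hα : Polynomial.aeval α (poly 0 (-1) (-1)) = 0) : nrComplexPlaces F = 1 := by
  have hsum := card_add_two_mul_card_eq_rank F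
  rw [h3] at hsum
  have hsign := NumberField.sign_discr F
  rw [discr_eq_neg_twentyThree h3 hα] at hsign
  have hle : nrComplexPlaces F ≤ 1 := by omega
  rcases Nat.le_one_iff_eq_zero_or_eq_one.mp hle with h0 | h1
  · rw [h0, pow_zero, show (-23 : ℤ).sign = -1 from rfl] at hsign
    norm_num at hsign
  · exact h1

/-- **`F` has exactly one real place** (`r₁ = 1`). [cite: LMFDB, number field 3.1.23.1 (signature [1,1])] -/
theorem nrRealPlaces_eq_one (h3 : finrank ℚ F = 3) (hα : Polynomial.aeval α (poly 0 (-1) (-1)) = 0) : nrRealPlaces F = 1 := by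
  have hsum := card_add_two_mul_card_eq_rank F
  rw [h3, nrComplexPlaces_eq_one h3 hα] at hsum
  omega

/-- `F` has two infinite places. [cite: LMFDB, number field 3.1.23.1 (signature [1,1])] -/
theorem card_infinitePlace_eq_two (h3 : finrank ℚ F = 3) (hα : Polynomial.aeval α (poly 0 (-1) (-1)) = 0) :
    Fintype.card (InfinitePlace F) = 2 := by
  rw [card_eq_nrRealPlaces_add_nrComplexPlaces, nrRealPlaces_eq_one h3 hα, nrComplexPlaces_eq_one h3 hα]

/-! ## §2 Class number one -/

/-- **`𝓞_F` is a principal ideal domain** — Minkowski: every ideal class contains an ideal of norm `≤ (4/π)^{r₂} (n!/nⁿ) √|d_F| = (4/π)(6/27)√23 < 2`;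
in Mathlib's form `|d_F| < (2 (π/4)^{r₂} nⁿ/n!)²`, here `23 < 81π²/16`. [cite: LMFDB, number field 3.1.23.1 (class number 1)] -/
theorem isPrincipalIdealRing (h3 : finrank ℚ F = 3) (hα : Polynomial.aeval α (poly 0 (-1) (-1)) = 0) : IsPrincipalIdealRing (𝓞 F) := by
  apply RingOfIntegers.isPrincipalIdealRing_of_abs_discr_lt
  rw [nrComplexPlaces_eq_one h3 hα, h3, discr_eq_neg_twentyThree h3 hα]
  have hπ := Real.pi_gt_three
  norm_num [Nat.factorial]
  nlinarith [hπ, Real.pi_pos]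

/-- **`h_F = 1`.** [cite: LMFDB, number field 3.1.23.1 (class number 1)] -/
theorem classNumber_eq_one (h3 : finrank ℚ F = 3) (hα : Polynomial.aeval α (poly 0 (-1) (-1)) = 0) : classNumber F = 1 :=
  (classNumber_eq_one_iff (K := F)).mpr (isPrincipalIdealRing h3 hα)

/-! ## §3 Units -/

/-- **The unit group of `𝓞_F` has rank `1`** (`r₁ + r₂ − 1`; a fundamental unit is `α` itself, `N(α) = 1`).
[cite: LMFDB, number field 3.1.23.1 (unit rank 1)] -/
theorem units_rank_eq_one (h3 : finrank ℚ F = 3) (hα : Polynomial.aeval α (poly 0 (-1) (-1)) = 0) : Units.rank F = 1 := by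
  rw [Units.rank, card_infinitePlace_eq_two h3 hα]

/-- **`w_F = 2`**: the only roots of unity in `F` are `±1` (odd degree). [cite: LMFDB, number field 3.1.23.1 (torsion generator −1, order 2)] -/
theorem torsionOrder_eq_two (h3 : finrank ℚ F = 3) : torsionOrder F = 2 :=
  torsionOrder_eq_two_of_odd_finrank (by rw [h3]; decide)

/-! ## §4 Norms of algebraic integers of `F` -/

/-- **A prime `p` is the norm of a principal ideal `(x) ⊆ 𝓞_F` iff `X³ − X − 1` has a root modulo `p`** (all ideals are principal, and the number of
ideals of norm `p` is `N_p(X³ − X − 1)`). [cite: Serre2003Jordan, §5.3 and note 5.3] [cite: Zagier2008, §4.3 (p. 59)] [cite: LMFDB, number field 3.1.23.1] -/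
theorem exists_absNorm_span_singleton_eq_iff (h3 : finrank ℚ F = 3) (hα : Polynomial.aeval α (poly 0 (-1) (-1)) = 0) {p : ℕ}
    (hp : p.Prime) : (∃ x : 𝓞 F, absNorm (span {x}) = p) ↔ ∃ r : ZMod p, r ^ 3 - r - 1 = 0 := by
  haveI : NeZero p := ⟨hp.ne_zero⟩
  haveI := isPrincipalIdealRing h3 hα
  constructor
  · rintro ⟨x, hx⟩
    have hpos : 0 < idealNormCount F p := Nat.card_pos_iff.mpr ⟨⟨⟨span {x}, hx⟩⟩, inferInstance⟩
    rw [idealNormCount_prime_eq_ncard_roots h3 hα hp] at hpos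
    obtain ⟨r, hr⟩ := Set.nonempty_of_ncard_ne_zero hpos.ne'
    exact ⟨r, hr⟩
  · rintro ⟨r, hr⟩
    have hpos : 0 < {r : ZMod p | r ^ 3 - r - 1 = 0}.ncard := (Set.ncard_pos (Set.toFinite _)).mpr ⟨r, hr⟩
    rw [← idealNormCount_prime_eq_ncard_roots h3 hα hp, idealNormCount] at hpos
    obtain ⟨⟨⟨I, hI⟩⟩, -⟩ := Nat.card_pos_iff.mp hpos
    obtain ⟨x, hx⟩ := Submodule.IsPrincipal.principal I
    exact ⟨x, by rw [← hI, hx]⟩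

/-- **`±p` is a norm `N_{F/ℚ}(x)`, `x ∈ 𝓞_F`, iff `X³ − X − 1` has a root modulo `p`** (`|N(x)| = N((x))`).
[cite: Serre2003Jordan, §5.3 and note 5.3] [cite: Zagier2008, §4.3 (p. 59)] [cite: LMFDB, number field 3.1.23.1] -/
theorem exists_natAbs_norm_eq_iff (h3 : finrank ℚ F = 3) (hα : Polynomial.aeval α (poly 0 (-1) (-1)) = 0) {p : ℕ} (hp : p.Prime) :
    (∃ x : 𝓞 F, (Algebra.norm ℤ x).natAbs = p) ↔ ∃ r : ZMod p, r ^ 3 - r - 1 = 0 := by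
  rw [← exists_absNorm_span_singleton_eq_iff h3 hα hp]
  simp only [Ideal.absNorm_span_singleton]

end Literature.NumberTheory.CubicFields.CubicDisc23
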